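import Mathlib.InformationTheory.KullbackLeibler.Basic
import Mathlib.Analysis.Convex.SpecificFunctions.Basic
import Mathlib.Analysis.Convex.SpecificFunctions.Pow
import Mathlib.Analysis.Normed.Module.Convex
import HarnessLib

/-!
# Csiszár `f`-divergences

Topic `Literature/Probability/Divergences`; definition item `defn-fDiv` (wanted by route
`AtomisticToContinuum/ExpTailStaging`, negative-side support `DivergenceClassNoGo`).
Mathlib (this snapshot) has the Kullback–Leibler divergence `InformationTheory.klDiv` and its
generator `InformationTheory.klFun x = x log x + 1 - x`, but no general `f`-divergence.

## Contents

* `derivAtTop f : ℝ≥0∞` — the slope at infinity `f'(∞) = lim_{x → ∞} f(x) / x ∈ [0, ∞]` of a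
  generator (for a convex `f` the limit exists in `(-∞, ∞]`; we take the `limsup` of
  `ENNReal.ofReal (f x / x)`, which is that limit for the nonnegative generators used here).
* `fDiv f μ ν : ℝ≥0∞` — the **`f`-divergence**
  `D_f(μ ‖ ν) = ∫ f (dμ/dν) dν + f'(∞) · μ^⊥(univ)`, `μ^⊥ = μ.singularPart ν`
  ([PolyanskiyWu2024, Def. 7.1 and eq. (7.2)]: `∫_{q>0} q f(p/q) dλ + f'(∞) P[q = 0]`, with the
  agreement `f'(∞) · 0 = 0` — which is `ℝ≥0∞`'s `∞ * 0 = 0`).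
* Generators (all convex on `[0, ∞)`, vanishing at `1`, NONNEGATIVE — each with proved
  `_nonneg`, `convexOn_`, and slope-at-infinity lemmas): Mathlib's `klFun` (Kullback–Leibler,
  `klFun'(∞) = ∞`), `chiSqFun x = (x - 1)²` (`χ²`, slope `∞`), `sqHellingerFun x = (1 - √x)²`
  (squared Hellinger, slope `1`), `tvFun x = |x - 1| / 2` (total variation, slope `1/2`); the
  divergences `chiSqFDiv`, `sqHellingerDiv`, `tvDiv` as `abbrev`s of `fDiv`
  ([PolyanskiyWu2024, eqs. (7.3)–(7.5)]). The power (Hellinger/Rényi) family of orders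
  `a ∈ (0,1) ∪ (1,∞)` lives in the sibling file `RenyiDivergence.lean`.
* PROVED API: `derivAtTop_of_tendsto`, `derivAtTop_of_tendsto_atTop`; `fDiv_of_ac` (absolutely
  continuous case = (7.1)), `fDiv_eq_top_of_not_ac` (`f'(∞) = ∞`, `μ` not `≪ ν` ⇒ `D_f = ∞`),
  `fDiv_self` (`D_f(μ‖μ) = 0`, [PolyanskiyWu2024, Prop. 7.2 (2)]), `fDiv_of_mutuallySingular`
  (`D_f(μ‖ν) = f(0) ν(univ) + f'(∞) μ(univ)` for `μ ⟂ ν`, [PolyanskiyWu2024, eq. (7.12)]),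
  and the bridge to Mathlib `klDiv_eq_fDiv : klDiv μ ν = fDiv klFun μ ν` (finite measures).

## Design (read before use)

* VALUES IN `ℝ≥0∞`, NONNEGATIVE GENERATORS. The integral is the lower Lebesgue integral of
  `ENNReal.ofReal (f (dμ/dν))`, so NEGATIVE VALUES OF `f` ARE TRUNCATED TO `0`: `fDiv f` is the
  `f`-divergence of the literature exactly when `f ≥ 0` on `[0, ∞)`. This loses no
  `f`-divergence between probability measures: generators differing by `c (x - 1)` give the
  same divergence, so one "can always assume `f ≥ 0`" by subtracting the tangent at `1`
  ([PolyanskiyWu2024, Prop. 7.2 (6)]); all generators in this file are so normalised, and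
  Mathlib's `klDiv` uses the same convention (`klFun = x log x + 1 - x` rather than `x log x`).
  For finite measures of different mass the normalised and un-normalised generators differ by
  `c (μ(univ) - ν(univ))`.
* `μ.rnDeriv ν` / `μ.singularPart ν` are Mathlib's (junk `0` without a Lebesgue
  decomposition); all statements of substance assume `[μ.HaveLebesgueDecomposition ν]`, which
  holds for σ-finite measures.
* No convexity is baked into `fDiv`: theorems that need it (data processing, convexity,
  variational representation) must assume `ConvexOn ℝ (Set.Ici 0) f`, `f 1 = 0`, `0 ≤ f`.

## Deliberately NOT here (no unproved facts are introduced by this file)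

The data-processing inequality [PolyanskiyWu2024, Thm. 7.4], joint convexity
[PolyanskiyWu2024, Thm. 7.5], the partition supremum [PolyanskiyWu2024, Thm. 7.6] and the
variational representation [PolyanskiyWu2024, Thm. 7.26] are theorems about `fDiv` to be
vendored (proved or as cited named facts) in sibling files of this directory; the identity
`Literature.Probability.Entropy.chiSqDiv = chiSqFDiv` likewise (that file is downstream). No
"super-KL" generator `x (log x)^β` is defined (no printed source; any generator can be fed to
`fDiv`).

## References

* I. Csiszár, *Information-type measures of difference of probability distributions and
  indirect observations*, Studia Sci. Math. Hungar. 2 (1967) 299–318 (origin of the notion).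
* [PolyanskiyWu2024] Y. Polyanskiy, Y. Wu, *Information Theory: From Coding to Learning*,
  CUP 2024, Ch. 7 (read: authors' PDF, book pp. 115–121, 145, 147–148).
* [VanervenHarremoes2014] T. van Erven, P. Harremoës, *Rényi divergence and Kullback–Leibler
  divergence*, IEEE Trans. Inform. Theory 60 (2014) 3797–3820, §II (read: arXiv:1206.2459).
* F. Liese, I. Vajda, *On divergences and informations in statistics and information theory*,
  IEEE Trans. Inform. Theory 52 (2006) 4394–4412 (normalised power divergences; not consulted —
  paywalled, acquisition request acq-03737).
-/

noncomputable section

open _root_.MeasureTheory _root_.InformationTheory Filter Set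
open scoped ENNReal NNReal Topology

namespace Literature.Probability.Divergences

variable {α : Type*} [MeasurableSpace α]

/-! ### The slope at infinity of a generator -/

/-- The **slope at infinity** `f'(∞) = lim_{x → ∞} f(x) / x` of a generator `f`, valued in
`ℝ≥0∞`: the `limsup` along `atTop` of `ENNReal.ofReal (f x / x)`. For a convex `f` the quotient
converges in `(-∞, ∞]` and this is `max (lim f(x)/x) 0`; for the nonnegative generators of this
file it is the literature's `f'(∞)` (written `lim_{x ↓ 0} x f(1/x)` in the source).
[cite: PolyanskiyWu2024, Def. 7.1] -/
def derivAtTop (f : ℝ → ℝ) : ℝ≥0∞ :=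
  limsup (fun x : ℝ => ENNReal.ofReal (f x / x)) atTop

/-- If `f x / x → c` then `f'(∞) = c` (truncated at `0`). [folklore] -/
theorem derivAtTop_of_tendsto {f : ℝ → ℝ} {c : ℝ}
    (h : Tendsto (fun x => f x / x) atTop (𝓝 c)) : derivAtTop f = ENNReal.ofReal c :=
  ((ENNReal.continuous_ofReal.tendsto c).comp h).limsup_eq

/-- If `f x / x → +∞` then `f'(∞) = ∞` (superlinear generators). [folklore] -/
theorem derivAtTop_of_tendsto_atTop {f : ℝ → ℝ}
    (h : Tendsto (fun x => f x / x) atTop atTop) : derivAtTop f = ∞ :=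
  (ENNReal.tendsto_ofReal_atTop.comp h).limsup_eq

/-- The Kullback–Leibler generator `klFun x = x log x + 1 - x` is superlinear:
`klFun'(∞) = ∞`. [folklore] -/
theorem derivAtTop_klFun : derivAtTop klFun = ∞ := by
  refine derivAtTop_of_tendsto_atTop ?_
  have h : Tendsto (fun x : ℝ => Real.log x + (x⁻¹ - 1)) atTop atTop :=
    Real.tendsto_log_atTop.atTop_add (tendsto_inv_atTop_zero.sub_const 1)
  refine h.congr' ?_
  filter_upwards [eventually_gt_atTop 0] with x hx
  rw [klFun_apply]
  field_simp
  ring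

/-! ### The `f`-divergence -/

/-- The **`f`-divergence** (Csiszár) of two measures `μ`, `ν` for a generator `f : ℝ → ℝ`
(intended: convex on `[0,∞)`, `f 1 = 0`, `f ≥ 0`), valued in `ℝ≥0∞`:
`D_f(μ ‖ ν) = ∫ f(dμ/dν) dν + f'(∞) · (μ.singularPart ν) univ`,
i.e. `∫_{q > 0} q f(p/q) dλ + f'(∞) · μ[q = 0]` for densities `p, q` w.r.t. any dominating `λ`,
with `f'(∞) · 0 = 0`. Negative values of `f` are truncated (see the module docstring: use
nonnegative, tangent-normalised generators). [cite: PolyanskiyWu2024, Def. 7.1, eq. (7.2)] -/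
def fDiv (f : ℝ → ℝ) (μ ν : Measure α) : ℝ≥0∞ :=
  (∫⁻ x, ENNReal.ofReal (f (μ.rnDeriv ν x).toReal) ∂ν) + derivAtTop f * μ.singularPart ν univ

section Basic

variable {f : ℝ → ℝ} {μ ν : Measure α}

/-- Unfolding `fDiv`. [folklore] -/
theorem fDiv_def (f : ℝ → ℝ) (μ ν : Measure α) :
    fDiv f μ ν = (∫⁻ x, ENNReal.ofReal (f (μ.rnDeriv ν x).toReal) ∂ν)
      + derivAtTop f * μ.singularPart ν univ := rfl

/-- For `μ ≪ ν` the singular term vanishes: `D_f(μ ‖ ν) = ∫ f(dμ/dν) dν`.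
[cite: PolyanskiyWu2024, Def. 7.1, eq. (7.1)] -/
theorem fDiv_of_ac (h : μ ≪ ν) :
    fDiv f μ ν = ∫⁻ x, ENNReal.ofReal (f (μ.rnDeriv ν x).toReal) ∂ν := by
  rw [fDiv, Measure.singularPart_eq_zero_of_ac h]
  simp

/-- The integral part is bounded by the divergence. [folklore] -/
theorem lintegral_le_fDiv (f : ℝ → ℝ) (μ ν : Measure α) :
    ∫⁻ x, ENNReal.ofReal (f (μ.rnDeriv ν x).toReal) ∂ν ≤ fDiv f μ ν :=
  le_self_add

/-- The singular part is bounded by the divergence. [folklore] -/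
theorem derivAtTop_mul_singularPart_le_fDiv (f : ℝ → ℝ) (μ ν : Measure α) :
    derivAtTop f * μ.singularPart ν univ ≤ fDiv f μ ν :=
  le_add_self

/-- A superlinear generator (`f'(∞) = ∞`) gives `D_f(μ ‖ ν) = ∞` unless `μ ≪ ν`.
[cite: PolyanskiyWu2024, Def. 7.1, eq. (7.2)] -/
theorem fDiv_eq_top_of_not_ac [μ.HaveLebesgueDecomposition ν] (hf : derivAtTop f = ∞)
    (h : ¬ μ ≪ ν) : fDiv f μ ν = ∞ := by
  have h1 : μ.singularPart ν univ ≠ 0 := by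
    rw [ne_eq, Measure.measure_univ_eq_zero, Measure.singularPart_eq_zero]
    exact h
  rw [fDiv, hf, ENNReal.top_mul h1, add_top]

/-- `D_f(μ ‖ μ) = 0` when `f 1 = 0`. [cite: PolyanskiyWu2024, Prop. 7.2 (2)] -/
theorem fDiv_self (hf : f 1 = 0) (μ : Measure α) [SigmaFinite μ] : fDiv f μ μ = 0 := by
  rw [fDiv_of_ac Measure.AbsolutelyContinuous.rfl]
  calc ∫⁻ x, ENNReal.ofReal (f (μ.rnDeriv μ x).toReal) ∂μ = ∫⁻ _, ENNReal.ofReal (f 1) ∂μ := by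
        refine lintegral_congr_ae ?_
        filter_upwards [Measure.rnDeriv_self μ] with x hx
        rw [hx, ENNReal.toReal_one]
    _ = 0 := by simp [hf]

/-- Mutually singular measures: `D_f(μ ‖ ν) = f(0) · ν(univ) + f'(∞) · μ(univ)`
(`= f(0) + f'(∞)` for probability measures). [cite: PolyanskiyWu2024, Prop. 7.2 (3), eq. (7.12)] -/
theorem fDiv_of_mutuallySingular (h : μ ⟂ₘ ν) :
    fDiv f μ ν = ENNReal.ofReal (f 0) * ν univ + derivAtTop f * μ univ := by
  rw [fDiv, Measure.singularPart_eq_self.mpr h]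
  congr 1
  calc ∫⁻ x, ENNReal.ofReal (f (μ.rnDeriv ν x).toReal) ∂ν = ∫⁻ _, ENNReal.ofReal (f 0) ∂ν := by
        refine lintegral_congr_ae ?_
        filter_upwards [h.rnDeriv_ae_eq_zero] with x hx
        rw [hx, Pi.zero_apply, ENNReal.toReal_zero]
    _ = ENNReal.ofReal (f 0) * ν univ := lintegral_const _

/-- **Kullback–Leibler divergence is the `f`-divergence of `klFun`**: for finite measures,
Mathlib's `klDiv μ ν` equals `fDiv klFun μ ν` (both are `∞` unless `μ ≪ ν`, since
`klFun'(∞) = ∞`). [folklore] -/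
theorem klDiv_eq_fDiv [IsFiniteMeasure μ] [IsFiniteMeasure ν] : klDiv μ ν = fDiv klFun μ ν := by
  by_cases h : μ ≪ ν
  · rw [klDiv_eq_lintegral_klFun_of_ac h, fDiv_of_ac h]
  · rw [klDiv_of_not_ac h, fDiv_eq_top_of_not_ac derivAtTop_klFun h]

end Basic

/-! ### Standard generators and the corresponding divergences -/

/-- Affine functions are convex. [folklore] -/
theorem convexOn_affine (c d : ℝ) {s : Set ℝ} (hs : Convex ℝ s) :
    ConvexOn ℝ s (fun x => c * x + d) := by
  refine ⟨hs, fun x _ y _ p q _ _ hpq => le_of_eq ?_⟩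
  simp only [smul_eq_mul]
  linear_combination (-d) * hpq

/-- The `χ²` generator `f(x) = (x - 1)²`. [cite: PolyanskiyWu2024, eq. (7.4)] -/
def chiSqFun (x : ℝ) : ℝ := (x - 1) ^ 2

/-- Unfolding `chiSqFun`. [folklore] -/
@[simp] theorem chiSqFun_apply (x : ℝ) : chiSqFun x = (x - 1) ^ 2 := rfl

/-- The `χ²` generator is superlinear: `chiSqFun'(∞) = ∞`. [folklore] -/
theorem derivAtTop_chiSqFun : derivAtTop chiSqFun = ∞ := by
  refine derivAtTop_of_tendsto_atTop ?_
  have h : Tendsto (fun x : ℝ => x + (x⁻¹ - 2)) atTop atTop :=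
    tendsto_id.atTop_add (tendsto_inv_atTop_zero.sub_const 2)
  refine h.congr' ?_
  filter_upwards [eventually_gt_atTop 0] with x hx
  rw [chiSqFun_apply]
  field_simp
  ring

/-- The `χ²` generator is nonnegative. [folklore] -/
theorem chiSqFun_nonneg (x : ℝ) : 0 ≤ chiSqFun x := sq_nonneg _

/-- `chiSqFun 1 = 0`. [folklore] -/
@[simp] theorem chiSqFun_one : chiSqFun 1 = 0 := by simp [chiSqFun]

/-- The `χ²` generator is convex on `[0, ∞)`. [folklore] -/
theorem convexOn_chiSqFun : ConvexOn ℝ (Ici 0) chiSqFun := by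
  refine ((convexOn_pow 2).add (convexOn_affine (-2) 1 (convex_Ici 0))).congr fun x _ => ?_
  simp only [chiSqFun_apply, Pi.add_apply]
  ring

/-- The **`χ²`-divergence** `χ²(μ ‖ ν) = ∫ (dμ/dν - 1)² dν` (`= ∞` unless `μ ≪ ν`) as an
`f`-divergence. (The earlier stand-alone `Literature.Probability.Entropy.chiSqDiv` agrees with it
for measures with a Lebesgue decomposition.) [cite: PolyanskiyWu2024, eq. (7.4)] -/
abbrev chiSqFDiv (μ ν : Measure α) : ℝ≥0∞ := fDiv chiSqFun μ ν

/-- The squared-Hellinger generator `f(x) = (1 - √x)²`. [cite: PolyanskiyWu2024, eq. (7.5)] -/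
def sqHellingerFun (x : ℝ) : ℝ := (1 - Real.sqrt x) ^ 2

/-- Unfolding `sqHellingerFun`. [folklore] -/
@[simp] theorem sqHellingerFun_apply (x : ℝ) : sqHellingerFun x = (1 - Real.sqrt x) ^ 2 := rfl

/-- The squared-Hellinger generator is nonnegative. [folklore] -/
theorem sqHellingerFun_nonneg (x : ℝ) : 0 ≤ sqHellingerFun x := sq_nonneg _

/-- `sqHellingerFun 1 = 0`. [folklore] -/
@[simp] theorem sqHellingerFun_one : sqHellingerFun 1 = 0 := by simp [sqHellingerFun]

/-- The squared-Hellinger generator is convex on `[0, ∞)` (`= x + 1 - 2√x`). [folklore] -/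
theorem convexOn_sqHellingerFun : ConvexOn ℝ (Ici 0) sqHellingerFun := by
  refine (((Real.strictConcaveOn_sqrt.concaveOn.neg).smul (zero_le_two (α := ℝ))).add
    (convexOn_affine 1 1 (convex_Ici 0))).congr fun x hx => ?_
  simp only [sqHellingerFun_apply, Pi.add_apply, Pi.neg_apply, smul_eq_mul]
  linear_combination (-1 : ℝ) * Real.sq_sqrt (Set.mem_Ici.mp hx)

/-- The squared-Hellinger generator has slope `1` at infinity (`(1 - √x)² / x → 1`). [folklore] -/
theorem derivAtTop_sqHellingerFun : derivAtTop sqHellingerFun = 1 := by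
  rw [← ENNReal.ofReal_one]
  refine derivAtTop_of_tendsto ?_
  have h : Tendsto (fun x : ℝ => ((Real.sqrt x)⁻¹ - 1) ^ 2) atTop (𝓝 ((0 - 1) ^ 2)) :=
    ((tendsto_inv_atTop_zero.comp Real.tendsto_sqrt_atTop).sub_const 1).pow 2
  rw [show ((0 : ℝ) - 1) ^ 2 = 1 by norm_num] at h
  refine h.congr' ?_
  filter_upwards [eventually_gt_atTop 0] with x hx
  have hs : Real.sqrt x ≠ 0 := (Real.sqrt_pos.mpr hx).ne'
  rw [sqHellingerFun_apply]
  symm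
  calc (1 - Real.sqrt x) ^ 2 / x = (1 - Real.sqrt x) ^ 2 / Real.sqrt x ^ 2 := by
        rw [Real.sq_sqrt hx.le]
    _ = ((1 - Real.sqrt x) / Real.sqrt x) ^ 2 := by rw [div_pow]
    _ = ((Real.sqrt x)⁻¹ - 1) ^ 2 := by
        congr 1
        field_simp

/-- The **squared Hellinger distance** `H²(μ, ν) = ∫ (√dμ - √dν)²` as an `f`-divergence.
[cite: PolyanskiyWu2024, eq. (7.5)] -/
abbrev sqHellingerDiv (μ ν : Measure α) : ℝ≥0∞ := fDiv sqHellingerFun μ ν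

/-- The total-variation generator `f(x) = |x - 1| / 2`. [cite: PolyanskiyWu2024, eq. (7.3)] -/
def tvFun (x : ℝ) : ℝ := |x - 1| / 2

/-- Unfolding `tvFun`. [folklore] -/
@[simp] theorem tvFun_apply (x : ℝ) : tvFun x = |x - 1| / 2 := rfl

/-- The total-variation generator is nonnegative. [folklore] -/
theorem tvFun_nonneg (x : ℝ) : 0 ≤ tvFun x := by
  rw [tvFun_apply]; positivity

/-- `tvFun 1 = 0`. [folklore] -/
@[simp] theorem tvFun_one : tvFun 1 = 0 := by simp [tvFun]

/-- The total-variation generator is convex (on all of `ℝ`). [folklore] -/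
theorem convexOn_tvFun : ConvexOn ℝ univ tvFun := by
  have h := ((convexOn_univ_norm (E := ℝ)).translate_right (-1)).smul
    (show (0 : ℝ) ≤ 1 / 2 by norm_num)
  rw [Set.preimage_univ] at h
  refine h.congr fun x _ => ?_
  simp only [tvFun_apply, Function.comp_apply, Real.norm_eq_abs, smul_eq_mul]
  rw [neg_add_eq_sub]
  ring

/-- The total-variation generator has slope `1/2` at infinity. [folklore] -/
theorem derivAtTop_tvFun : derivAtTop tvFun = ENNReal.ofReal (1 / 2) := by
  refine derivAtTop_of_tendsto ?_
  have h : Tendsto (fun x : ℝ => 1 / 2 - x⁻¹ / 2) atTop (𝓝 (1 / 2 - 0 / 2)) :=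
    tendsto_const_nhds.sub (tendsto_inv_atTop_zero.div_const 2)
  rw [zero_div, sub_zero] at h
  refine h.congr' ?_
  filter_upwards [eventually_ge_atTop 1] with x hx
  rw [tvFun_apply, abs_of_nonneg (by linarith)]
  field_simp

/-- The **total variation distance** `TV(μ, ν) = ½ ∫ |dμ - dν|` as an `f`-divergence.
[cite: PolyanskiyWu2024, eq. (7.3)] -/
abbrev tvDiv (μ ν : Measure α) : ℝ≥0∞ := fDiv tvFun μ ν

end Literature.Probability.Divergences
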